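import Literature.MathematicalPhysics.QuantumFieldTheory.Balaban1983to89.B9Ineq385V3RightKernel
import Literature.MathematicalPhysics.QuantumFieldTheory.Balaban1983to89.B9Ineq377POneRightKernel
import Literature.MathematicalPhysics.QuantumFieldTheory.Balaban1983to89.B9Ineq346L2SecondDiff
import Literature.MathematicalPhysics.QuantumFieldTheory.Balaban1983to89.B9Thm34PPrimeKernelFinal

/-!
# `Balaban1983to89.B9Ineq346L2RightDiffG` — [Balaban1985BackgroundPropagators] THEOREM 3.4 p. 400 × THEOREM 3.3 p. 399 × (3.46)₆ p. 398:
# THE `L²` MEMBER WITH TWO RIGHT DIFFERENCES («‖hG∇*_U∇*_UJ‖ ≦ B₀·1·|h|e^{−δ₀d(y,y′)}‖J‖») FOR THE EXTENDED OPERATOR `G(U′U)` OF FILE 28, AT THE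
# FINAL LEVEL — from (3.46)₆ FOR `U` (an `L²` block input), the second equality of (3.84)/(3.86) `G(U′U) = G(U) + G(U′U)V(A)G(U)`, and a KERNEL
# bound for `G(U′U)·V(A)` WITH `V(A) = V₃(A) + P₁(A) + P₂(A)` ON THE RIGHT (FILES 42/43 + column hypotheses for the abstract averaging letters);
# FILE 44 of the Sect. B programme of cell `lit-balaban`, seat r06 gen 19; closes item (O‴) of `B9-CLOSURE` and, with FILES 39–41, ALL members of
# (3.42)–(3.47) for BOTH extended operators

**What is printed.**  Theorem 3.3 (p. 399): *"the operators G(U), ∇^η_U G(U), … satisfy all the inequalities of Theorem 3.1"*, among them the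
`L²` member (3.46)₆ `‖hG(U)∇*_U∇*_Uλ‖ ≦ B₀|h|e^{−δ₀d(y,y′)}‖λ‖` (p. 398; the remark there: *"the choice of derivatives ∇_U, ∇*_U is conventional,
we can take arbitrary pairs"*).  Theorem 3.4 (p. 400) asserts the same for `G(U′U)`; its proof for `G` (p. 407): *"we have the equalities
(3.84) … G(U′U) = G(U) + G(U)V(A)G(U′U) = G(U) + G(U′U)V(A)G(U) (3.86) … Theorem (3.3) implies also convergence in all the norms appearing in its
formulation"*, with `V(A) = V₃(A) + P₁(A) + P₂(A)` ((3.82)–(3.84)), `P₁(A)` of (3.76)–(3.77), `P₂(A) = −(F₂*aQ + Q*aF₂ + F₂*aF₂)` of (3.82) with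
`|F₂(A)|, |F₂*(A)| ≦ O(1)α₁` ((3.80)–(3.81)).

**What this file proves** (`thm34_G_l2_right_final`).  HYPOTHESES = FILE 28 `B9Thm34AllFinal.thm34_all_final` VERBATIM + the bond-carrier
block volumes `hvol` and the `v^{−1/2}` transfer `hSTv` (as FILE 40) + Theorem 3.1's kernel members for `G′(U)` (`hGpk`, `hDGpk`, `hGpDk`,
`hDGpDk`, as FILES 16/29/33 — they feed FILE 33's (3.68) kernel members of `P′(A)`) + (3.35) in the second stencil shape `h35'` (as FILE 34 §5) +
NEW: the COLUMN (ℓ¹ block) bounds of the abstract averaging letters `Q`, `Q*`, `a` (U-side) and `F₂(A)`, `F₂*(A)` (A-side) — the transposes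
of the block majorants FILE 28 already takes ((3.15)/(3.26)/(3.80)–(3.81) bound these block-local kernels entrywise, so rows and columns
alike) — and (3.46)₆ FOR `G(U)` as an `L²` block input (`h346`).  CONCLUSION: FILE 28's pair `C⁻¹(U′U)`, `G(U′U)` (identities re-exported) with
`‖h·G(U′U)∇_k∇_mλ‖₂ ≦ B|h|e^{−(δ₀/50)d(y,y′)}‖λ‖₂` for every pair `k, m ∈ κ ⊕ κ` of concrete bond differences.

**Proof** (the route of FILE 41 for `G′`, now for `G`).  `resolvent_right` on `Δ_a(U)G(U) = 1`, `G(U′U)(Δ_a(U) − V(A)) = 1` ((3.84) by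
`eq384_sub` on FILE 28's identity) gives `G(U′U)∇∇ = G(U)∇∇ + [G(U′U)V(A)]·(G(U)∇∇)`; the right factor carries the `L²` input, and
`W = G(U′U)V(A)` needs a KERNEL bound with `V(A)` ON THE RIGHT of the kernel-bounded `G(U′U)`: (1) `G(U′U)·V₃(A)` = FILE 42
`hasKernelBound_mul_V₃_right` (columns of the concrete local letters from the gen-11 majorants + locality; FILE 28's kernel entries `G(U′U)`,
`G(U′U)∇_k`); (2) `G(U′U)·P₁(A)` = block majorant of `G(U′U)` (from its kernel, `hasMajorant_of_hasKernelBound`) × the KERNEL of `P₁(A)` with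
the kernel on the right letter (FILE 43 `hasKernelBound_pOne_right`, fed with Theorem 3.1's entries for `G′(U)` in both forms, the majorant
of `Q′*C⁻¹Q′` from (3.19)/(3.48) by `hasMajorantHom_word349`, and FILE 33's four (3.68) kernel members of `P′(A)` — FILE 33's `C⁻¹(U′U)`
identified with FILE 28's by `left_inv_eq_right_inv`); (3) `G(U′U)·P₂(A)`: three words `G(U′U)·L₁·a·L₃`, kernel × column × column × column
(FILE 41 `hasKernelBound_mul_col`).  The `α₁`-dependent constant is continuous, hence bounded below a threshold («of course with different
constants», p. 403); then FILE 41's `l2_right_transfer` (Minkowski + Schur + [4] (2.61)).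

**Honest scope.**  (3.46)₆ for `G(U)` is an INPUT ([4]'s `L²` regularity theory, (2.25)–(2.29), is Theorem 3.3's own content); the column
bounds of the ABSTRACT letters `Q, Q*, a, F₂, F₂*` are hypotheses (the tree types these letters abstractly; for the concrete (3.15) kernels they
are the transposes of the row bounds); rate `δ₀/50` and all constants explicit and lattice-independent but not optimised; group-valued
background, `η = g.eta`.  No `sorry`, no new definition, no new named fact.

statement-level skeleton of published theorems with citation tags; proofs where landed; nothing here is a claim about the Yang–Mills mass gap
-/

noncomputable section

namespace Literature.MathematicalPhysics.QuantumFieldTheory.Balaban1983to89.B9Ineq346L2RightDiffG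

open NormedSpace Complex
open Literature.MathematicalPhysics.QuantumFieldTheory.Balaban1983to89
open Literature.MathematicalPhysics.QuantumFieldTheory.Balaban1983to89.B6RandomWalk (HasMajorant BlockSupp hasMajorant_mono Triangle254 Ineq261)
open Literature.MathematicalPhysics.QuantumFieldTheory.Balaban1983to89.B6RandomWalkHom (HasMajorantHom hasMajorantHom_iff hasMajorantHom_mono)
open Literature.MathematicalPhysics.QuantumFieldTheory.Balaban1983to89.B6RandomWalkKernel (ker HasKernelBound hasKernelBound_mono hasKernelBound_add hasMajorant_of_hasKernelBound)
open Literature.MathematicalPhysics.QuantumFieldTheory.Balaban1983to89.B6RandomWalkSection (secExt secRes secConj hasMajorant_id_of_ker)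
open Literature.MathematicalPhysics.QuantumFieldTheory.Balaban1983to89.B9Thm34Ext (toB6)
open Literature.MathematicalPhysics.QuantumFieldTheory.Balaban1983to89.B9Ineq347 (ScaleTransfer)
open Literature.MathematicalPhysics.QuantumFieldTheory.Balaban1983to89.B9Eq386Neumann (vTotal pTwo deltaA eq384_sub)
open Literature.MathematicalPhysics.QuantumFieldTheory.Balaban1983to89.B9Eq39Adjoint
open Literature.MathematicalPhysics.QuantumFieldTheory.Balaban1983to89.B9Eq369Small (Through)
open Literature.MathematicalPhysics.QuantumFieldTheory.Balaban1983to89.B9Eq372Locality (stBonds)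
open Literature.MathematicalPhysics.QuantumFieldTheory.Balaban1983to89.B9Eq352DivForm (tauF tauB)
open Literature.MathematicalPhysics.QuantumFieldTheory.Balaban1983to89.B9Eq352DivFormLetters
open Literature.MathematicalPhysics.QuantumFieldTheory.Balaban1983to89.B9Eq352GradLetters (diffLetter)
open Literature.MathematicalPhysics.QuantumFieldTheory.Balaban1983to89.B9Eq371GradLetters (bT bU)
open Literature.MathematicalPhysics.QuantumFieldTheory.Balaban1983to89.B9Eq372RemLetters
open Literature.MathematicalPhysics.QuantumFieldTheory.Balaban1983to89.B9Eq382V3Letters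
open Literature.MathematicalPhysics.QuantumFieldTheory.Balaban1983to89.B9Eq376POneLetters (conjHom gradLin divLin eq376_concrete)
open Literature.MathematicalPhysics.QuantumFieldTheory.Balaban1983to89.B9Eq360Vprime (gPrimeExtEnd)
open Literature.MathematicalPhysics.QuantumFieldTheory.Balaban1983to89.B9Eq360VprimeLetters (vPrimeConc)
open Literature.MathematicalPhysics.QuantumFieldTheory.Balaban1983to89.B9Ineq385V3Concrete (cV0_nonneg)
open Literature.MathematicalPhysics.QuantumFieldTheory.Balaban1983to89.B9Ineq385Kernel (exp_rate_mono hasKernelBound_rate_mono hasKernelBound_comp_decay)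
open Literature.MathematicalPhysics.QuantumFieldTheory.Balaban1983to89.B9Thm34GKernelFinal (exists_bound_of_continuousAt)
open Literature.MathematicalPhysics.QuantumFieldTheory.Balaban1983to89.B9Thm34AllFinal (thm34_all_final)
open Literature.MathematicalPhysics.QuantumFieldTheory.Balaban1983to89.B9Thm34PPrimeKernelFinal (thm34_pPrime_kernel_final)
open Literature.MathematicalPhysics.QuantumFieldTheory.Balaban1983to89.B9Ineq349Hom (hasMajorantHom_word349)
open Literature.MathematicalPhysics.QuantumFieldTheory.Balaban1983to89.B9Ineq346L2RightDiff (hasKernelBound_mul_col l2_right_transfer)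
open Literature.MathematicalPhysics.QuantumFieldTheory.Balaban1983to89.B9Thm34HolderInputG (resolvent_right)
open Literature.MathematicalPhysics.QuantumFieldTheory.Balaban1983to89.B9Ineq385V3RightKernel (hasKernelBound_mul_V₃_right nbhd₁_mem_self nbhd₁_mem_fwd nbhd₁_mem_bwd nbhd₂_comp nbhd₂_symm nbhd₂_card)
open Literature.MathematicalPhysics.QuantumFieldTheory.Balaban1983to89.B9Ineq377POneRightKernel (hasKernelBound_pOne_right)

/-! ## §1  Plumbing: the kernel bound of `−T` -/

section Neg

variable {g : B9.Geometry} [Fintype g.Site] {R : ℝ} {H : Prop} {X : Type} [Fintype X] [DecidableEq X]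

omit [Fintype X] in
/-- `|(−T)(x,x′)| = |T(x,x′)|`. [folklore] -/
private theorem hasKernelBound_neg' (blk : X → g.Site) {v : g.Site → ℝ} {c : ℝ} {T : Module.End ℝ (X → ℝ)} {K : g.Site → g.Site → ℝ}
    (h : HasKernelBound (g := toB6 g R H) blk v c T K) : HasKernelBound (g := toB6 g R H) blk v c (-T) K := by
  intro x x'
  have e : ker c (-T) x x' = -ker c T x x' := by
    simp only [ker, LinearMap.neg_apply, Pi.neg_apply, mul_neg]
  rw [e, abs_neg]
  exact h x x'

end Neg

/-! ## §2  THEOREM 3.4 × THEOREM 3.3 × (3.46)₆ FOR THE `G(U′U)` OF FILE 28, PRINTED QUANTIFIERS -/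

section FinalG

variable {𝔸 : Type*} [NormedRing 𝔸] [NormedAlgebra ℂ 𝔸] [CompleteSpace 𝔸] {ι : Type} [Fintype ι]
variable (b : Module.Basis ι ℝ 𝔸) {S : Type} {κ : Type} [Fintype κ] [LinearOrder κ]
variable (T : κ → Equiv.Perm S) (U : κ → S → 𝔸ˣ)
variable {g : B9.Geometry} [Fintype g.Site] {Rr : ℝ} {H : Prop}

set_option maxHeartbeats 6400000 in
/-- **THEOREM 3.4 × THEOREM 3.3: THE `L²` MEMBER (3.46)₆ `‖hG∇*_U∇*_UJ‖ ≦ B₀|h|e^{−δ₀d(y,y′)}‖J‖` FOR THE `G(U′U)` OF FILE 28** (Theorem 3.3 p. 399;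
for `U′U` by Theorem 3.4 p. 400 and p. 407 «Theorem (3.3) implies also convergence in all the norms appearing in its formulation»).  HYPOTHESES =
FILE 28 `thm34_all_final` VERBATIM + `hvol` (bond carrier), `hSTv`, Theorem 3.1's kernel members for `G′(U)` (`hGpk hDGpk hGpDk hDGpDk`), (3.35) in
the second stencil shape (`h35'`) + NEW: column bounds of the abstract letters `Q, Q*, a` (`hQcol hQscol hacol`) and of `F₂(A), F₂*(A)` (inside the
`∀`), and (3.46)₆ FOR `G(U)` as an `L²` block input for every pair of concrete first differences (`h346`).  CONCLUSION `∃ a₁ > 0 ∃ B ≧ 0 ∀ α₁ ≦ a₁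
∀ A …` (FILE 28's premises verbatim + the two column premises) `∃ C⁻¹(U′U), G(U′U)` — FILE 28's pair ((ii)/(iii) identities re-exported) — with
`∀ k m ∀ y y′ ∀ h` (`|h| ≦ H`, `supp h ⊂ Δ(y)`) `∀ J` (`supp J ⊂ Δ(y′)`): `‖h·G(U′U)∇_k∇_mJ‖₂ ≦ BHe^{−(δ₀/50)d(y,y′)}‖J‖₂`.  PROOF: module docstring —
`resolvent_right`, kernel of `W = G(U′U)V(A)` from FILE 42 (V₃ part), FILE 43 × `hasMajorant_of_hasKernelBound` (P₁ part), `hasKernelBound_mul_col`³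
(P₂ part), continuity threshold, FILE 41's `l2_right_transfer`.
[cite: Balaban1985BackgroundPropagators, Thm 3.4 p.400 + Thm 3.3 p.399 + Thm 3.1 (3.46) p.398 + p.398 remark + (3.73) p.405 + (3.76)–(3.77) pp.405–406 + (3.80)–(3.86) p.407 + (3.15) p.392 + (3.19) p.393 + (3.48) p.398 + (3.68) p.403; Balaban1984PropagatorsII, (2.51)–(2.55) p.232 + (2.64)–(2.66) p.234 + Lemma 2.1 p.234] -/
theorem thm34_G_l2_right_final [Fintype S] [DecidableEq S] [DecidableEq ι] [DecidableEq g.Site] [Nonempty g.Site] (blk : S → g.Site) (d : ℕ)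
    (δ₀ B₀ κQ BG B₁ cF Cq a₀ C₀ d₀ M₂ κQb cFb abar κQc abarc cFc : ℝ)
    (kQ : g.Site → S → 𝔸 →L[ℝ] 𝔸) (sQ : S → 𝔸 →L[ℝ] 𝔸) (cfun w : g.Site → ℝ)
    (hB₀ : 0 ≤ B₀) (hκQ : 0 < κQ) (hBG : 0 < BG) (hB₁ : 0 < B₁) (hcF : 0 < cF) (hCq : 0 ≤ Cq) (ha₀ : 0 ≤ a₀) (hC₀ : 0 ≤ C₀)
    (hM₂ : 0 ≤ M₂) (hδ₀ : 0 < δ₀) (hκQb : 0 ≤ κQb) (hcFb : 0 ≤ cFb) (habar : 0 ≤ abar) (hκQc : 0 ≤ κQc) (habarc : 0 ≤ abarc)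
    (hcFc : 0 ≤ cFc)
    -- the multiscale geometry 𝔅 (p. 393, [4] (2.1)–(2.4)) and its axioms
    (hdnn : ∀ a a' : g.Site, 0 ≤ g.dist a a') (htri : Triangle254 (toB6 g Rr H)) (hrefl : ∀ y : g.Site, g.dist y y = 0)
    (hsym : ∀ y y' : g.Site, g.dist y y' = g.dist y' y) (hlen : ∀ y : g.Site, 0 < g.len y) (hlenη : ∀ y : g.Site, g.eta ≤ g.len y)
    (hη : 0 < g.eta) (hL : 1 ≤ g.L)
    -- [4] Lemma 2.1 (2.61) at the rate `δ₀`, «for every 0 < α < 1»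
    (h261 : ∀ α : ℝ, 0 < α → α < 1 → Ineq261 d (toB6 g Rr H) δ₀ α)
    -- p. 398: «Using Lemma 2.1 in [4] we may replace the factor (Lʲη)^α by (Lʲη)^β(L^{j′}η)^γ with β + γ = α» — for every exponent, one
    -- constant `Λ(α) ≧ 1` for the six weights `(Lʲη)^{1,2,−1,−2,−4}` (natural and real powers)
    (hST : ∀ α : ℝ, 0 < α → ∃ Λ : ℝ, 1 ≤ Λ ∧ ScaleTransfer g δ₀ α Λ (fun a => g.len a) ∧ ScaleTransfer g δ₀ α Λ (fun a => g.len a ^ 2) ∧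
      ScaleTransfer g δ₀ α Λ (fun a => (g.len a)⁻¹) ∧ ScaleTransfer g δ₀ α Λ (fun a => (g.len a ^ 2)⁻¹) ∧
      ScaleTransfer g δ₀ α Λ (fun a => (g.len a ^ 4)⁻¹) ∧ ScaleTransfer g δ₀ α Λ (fun y => g.len y ^ (-(4 : ℝ))))
    -- real coordinates of `𝔸`, commuting translations, unitary-type background
    (hrepr : ∀ (v : 𝔸) (i : ι), |b.repr v i| ≤ M₂ * ‖v‖) (hT : ∀ (μ ν : κ) (x : S), T μ (T ν x) = T ν (T μ x))
    (hU1 : ∀ m z, ‖((U m z : 𝔸ˣ) : 𝔸)‖ ≤ 1 ∧ ‖(((U m z)⁻¹ : 𝔸ˣ) : 𝔸)‖ ≤ 1)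
    -- (3.35) on the plaquettes through each bond, at that bond's block scale; stencil geometry at range `d₀`
    (h35 : ∀ μ x m n y, Through T μ x m n y → ‖(plaqU T U m n y : 𝔸) - 1‖ ≤ C₀ * ((g.L ^ g.scale (blk x))⁻¹) ^ 2)
    -- (3.35) on the plaquettes adjacent to a bond, in the second stencil shape (as FILE 34 §5 / FILE 42)
    (h35' : ∀ m n x, ‖(plaqU T U m n ((T n).symm x) : 𝔸) - 1‖ ≤ C₀ * ((g.L ^ g.scale (blk x))⁻¹) ^ 2)
    (hd₀B : ∀ μ x, g.dist (blk x) (blk ((T μ).symm x)) ≤ d₀) (hd₀F : ∀ μ x, g.dist (blk x) (blk (T μ x)) ≤ d₀)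
    (hd₀FB : ∀ μ ν x, g.dist (blk x) (blk ((T ν).symm (T μ x))) ≤ d₀)
    (hd₀st : ∀ μ x (q : κ × S), q ∈ stBonds T μ x → g.dist (blk x) (blk q.2) ≤ d₀)
    (hd₀loc : ∀ μ x (q : κ × S), q ∈ B9Eq375Locality.locBondsA' T μ x → g.dist (blk x) (blk q.2) ≤ d₀)
    (hd₀0 : ∀ y : g.Site, g.dist y y ≤ d₀)
    -- the `A`-independent data of the concrete `V′(A)` of (3.60): (3.19) kernels/multipliers and the `a`-weights of (3.24)
    (hw : ∀ y, 0 ≤ w y) (hcard : ∀ y, ((B9Eq360Vprime.block blk y).card : ℝ) * w y ≤ 1)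
    (hkQ : ∀ y x, blk x = y → ‖kQ y x‖ ≤ w y) (hsQ : ∀ x, ‖sQ x‖ ≤ 1) (hcfun : ∀ y, |cfun y| ≤ a₀ * (g.len y ^ 2)⁻¹)
    -- THEOREM 3.1 for `G′(U)`: (3.42)₁,₂,₃ at the rate `δ₀`
    {Gp : Module.End ℝ (S × ι → ℝ)}
    (h342_1 : HasMajorant (g := toB6 g Rr H) (fun p : S × ι => blk p.1) Gp
      (fun a a' => BG * g.len a ^ 2 * Real.exp (-(δ₀ * g.dist a a'))))
    (h342_2 : ∀ k : κ ⊕ κ, HasMajorant (g := toB6 g Rr H) (fun p : S × ι => blk p.1)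
      (conj b (diffLetter T U ((g.eta : ℂ)⁻¹) k) * Gp) (fun a a' => BG * g.len a * Real.exp (-(δ₀ * g.dist a a'))))
    (h342_3 : ∀ k : κ ⊕ κ, HasMajorant (g := toB6 g Rr H) (fun p : S × ι => blk p.1)
      (Gp * conj b (diffLetter T U ((g.eta : ℂ)⁻¹) k)) (fun a a' => BG * g.len a * Real.exp (-(δ₀ * g.dist a a'))))
    -- (kernel form, site carrier): Theorem 3.1's (3.42)₁₋₄ for `G′(U)` as PRINTED KERNEL BOUNDS (as FILES 16/29/33; same pairing and volume weights)
    {v : g.Site → ℝ} (hv : ∀ y, 0 < v y) {c : ℝ} (hc : 0 < c)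
    (hGpk : HasKernelBound (g := toB6 g Rr H) (fun p : S × ι => blk p.1) v c Gp (fun a a' => BG * g.len a ^ 2 * Real.exp (-(δ₀ * g.dist a a'))))
    (hDGpk : ∀ k : κ ⊕ κ, HasKernelBound (g := toB6 g Rr H) (fun p : S × ι => blk p.1) v c
      (conj b (diffLetter T U ((g.eta : ℂ)⁻¹) k) * Gp) (fun a a' => BG * g.len a * Real.exp (-(δ₀ * g.dist a a'))))
    (hGpDk : ∀ l : κ ⊕ κ, HasKernelBound (g := toB6 g Rr H) (fun p : S × ι => blk p.1) v c
      (Gp * conj b (diffLetter T U ((g.eta : ℂ)⁻¹) l)) (fun a a' => BG * g.len a * Real.exp (-(δ₀ * g.dist a a'))))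
    (hDGpDk : ∀ k l : κ ⊕ κ, HasKernelBound (g := toB6 g Rr H) (fun p : S × ι => blk p.1) v c
      (conj b (diffLetter T U ((g.eta : ℂ)⁻¹) k) * Gp * conj b (diffLetter T U ((g.eta : ℂ)⁻¹) l)) (fun a a' => BG * Real.exp (-(δ₀ * g.dist a a'))))
    -- (3.24): `G′(U) = (Δ′_a(U))⁻¹` for the letter `Δ′_a(U)`
    {Δp : Module.End ℝ (S × ι → ℝ)} (hΔpGp : Δp * Gp = 1) (hGpΔp : Gp * Δp = 1)
    -- the (3.19) letters `Q′(U)`, `Q′*(U)` in their own typing with block-local two-space majorants, a section of the block map (FILE 17)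
    (rep : g.Site → S × ι) (hrep : ∀ y : g.Site, blk (rep y).1 = y)
    {Qc : (S × ι → ℝ) →ₗ[ℝ] (g.Site → ℝ)} {Qcs : (g.Site → ℝ) →ₗ[ℝ] (S × ι → ℝ)} {Linv : Module.End ℝ (g.Site → ℝ)}
    (hQc : HasMajorantHom (g := toB6 g Rr H) (fun p : S × ι => blk p.1) (fun y : g.Site => y) Qc
      (fun a a' : g.Site => κQ * (if a = a' then (1 : ℝ) else 0)))
    (hQcs : HasMajorantHom (g := toB6 g Rr H) (fun y : g.Site => y) (fun p : S × ι => blk p.1) Qcs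
      (fun a a' : g.Site => κQ * (if a = a' then (1 : ℝ) else 0)))
    -- THEOREM 3.2 for `U`: (3.21) `C⁻¹ = (Q′G′²Q′*)⁻¹` exists (`hLinv`) with the KERNEL bound (3.48) at the rate `δ₀`
    (hLinv : (Qc ∘ₗ (Gp * Gp) ∘ₗ Qcs) * Linv = 1)
    (h348 : ∀ y y' : g.Site, |B9Thm34Inv.ker (B9Thm34Inv.vol g d) Linv y y'| ≤
      B₁ * g.len y ^ (-(4 : ℝ)) * g.len y' ^ (-(d : ℝ)) * Real.exp (-(δ₀ * g.dist y y')))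
    -- the (3.15) bond letters `Q(U)`, `Q*(U)` and the weight letter `a` of (3.24)/(3.26), with their majorants
    {G Qs Q a : Module.End ℝ ((κ × S) × ι → ℝ)}
    (hQb : HasMajorant (g := toB6 g Rr H) (fun q : (κ × S) × ι => blk q.1.2) Q (fun a a' => κQb * Real.exp (-(δ₀ * g.dist a a'))))
    (hQsb : HasMajorant (g := toB6 g Rr H) (fun q : (κ × S) × ι => blk q.1.2) Qs (fun a a' => κQb * Real.exp (-(δ₀ * g.dist a a'))))
    (ha324 : HasMajorant (g := toB6 g Rr H) (fun q : (κ × S) × ι => blk q.1.2) a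
      (fun a a' : g.Site => if a = a' then abar * (g.len a ^ 2)⁻¹ else 0))
    -- NEW: the COLUMN (ℓ¹ block) bounds of the (3.15) letters `Q(U)`, `Q*(U)` and of the weight letter `a` — the transposes of `hQb`, `hQsb`,
    -- `ha324` (printed shape: (3.15)/(3.26) — a block-local averaging kernel has row AND column sums `O(1)`)
    (hQcol : ∀ (x' : (κ × S) × ι) (y'' : g.Site), (∑ z ∈ Finset.univ.filter (fun z : (κ × S) × ι => blk z.1.2 = y''), |Q (Pi.single x' 1) z|) ≤
      κQc * Real.exp (-(δ₀ * g.dist y'' (blk x'.1.2))))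
    (hQscol : ∀ (x' : (κ × S) × ι) (y'' : g.Site), (∑ z ∈ Finset.univ.filter (fun z : (κ × S) × ι => blk z.1.2 = y''), |Qs (Pi.single x' 1) z|) ≤
      κQc * Real.exp (-(δ₀ * g.dist y'' (blk x'.1.2))))
    (hacol : ∀ (x' : (κ × S) × ι) (y'' : g.Site), (∑ z ∈ Finset.univ.filter (fun z : (κ × S) × ι => blk z.1.2 = y''), |a (Pi.single x' 1) z|) ≤
      abarc * (g.len y'' ^ 2)⁻¹ * Real.exp (-(δ₀ * g.dist y'' (blk x'.1.2))))
    -- THEOREM 3.3 for `G(U)`: two-sided inverse of the concrete `Δ_a(U)` and its (3.42)-entries at the rate `δ₀`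
    (hΔG : deltaA (conj b (lapDDLetter T ((g.eta : ℂ)⁻¹) U)) (conj b (dPrimeLetter T U g.eta))
      (conjHom b (gradLin T ((g.eta : ℂ)⁻¹) U) ∘ₗ (1 - (Gp ∘ₗ Qcs ∘ₗ Linv ∘ₗ Qc ∘ₗ Gp)) ∘ₗ conjHom b (divLin T ((g.eta : ℂ)⁻¹) U)) Qs a Q * G = 1)
    (hGΔ : G * deltaA (conj b (lapDDLetter T ((g.eta : ℂ)⁻¹) U)) (conj b (dPrimeLetter T U g.eta))
      (conjHom b (gradLin T ((g.eta : ℂ)⁻¹) U) ∘ₗ (1 - (Gp ∘ₗ Qcs ∘ₗ Linv ∘ₗ Qc ∘ₗ Gp)) ∘ₗ conjHom b (divLin T ((g.eta : ℂ)⁻¹) U)) Qs a Q = 1)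
    (hG : HasMajorant (g := toB6 g Rr H) (fun q : (κ × S) × ι => blk q.1.2) G
      (fun a a' => B₀ * g.len a ^ 2 * Real.exp (-(δ₀ * g.dist a a'))))
    (hDG : ∀ k : κ ⊕ κ, HasMajorant (g := toB6 g Rr H) (fun q : (κ × S) × ι => blk q.1.2)
      (conj b (diffLetter (bT T) (bU U) ((g.eta : ℂ)⁻¹) k) * G) (fun a a' => B₀ * g.len a * Real.exp (-(δ₀ * g.dist a a'))))
    (hGD : ∀ k : κ ⊕ κ, HasMajorant (g := toB6 g Rr H) (fun q : (κ × S) × ι => blk q.1.2)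
      (G * conj b (diffLetter (bT T) (bU U) ((g.eta : ℂ)⁻¹) k)) (fun a a' => B₀ * g.len a * Real.exp (-(δ₀ * g.dist a a'))))
    -- (kernel form): Theorem 3.3's (3.42)₁,₂,₃,₄ for `G(U)` as PRINTED KERNEL BOUNDS (pairing weight `c = η^d`, volume weight `v(y′) = (L^j′ η)^d`)
    (hGk : HasKernelBound (g := toB6 g Rr H) (fun q : (κ × S) × ι => blk q.1.2) v c G
      (fun a a' => B₀ * g.len a ^ 2 * Real.exp (-(δ₀ * g.dist a a'))))
    (hDGk : ∀ k : κ ⊕ κ, HasKernelBound (g := toB6 g Rr H) (fun q : (κ × S) × ι => blk q.1.2) v c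
      (conj b (diffLetter (bT T) (bU U) ((g.eta : ℂ)⁻¹) k) * G) (fun a a' => B₀ * g.len a * Real.exp (-(δ₀ * g.dist a a'))))
    (hGDk : ∀ l : κ ⊕ κ, HasKernelBound (g := toB6 g Rr H) (fun q : (κ × S) × ι => blk q.1.2) v c
      (G * conj b (diffLetter (bT T) (bU U) ((g.eta : ℂ)⁻¹) l)) (fun a a' => B₀ * g.len a * Real.exp (-(δ₀ * g.dist a a'))))
    (hDGDk : ∀ k l : κ ⊕ κ, HasKernelBound (g := toB6 g Rr H) (fun q : (κ × S) × ι => blk q.1.2) v c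
      (conj b (diffLetter (bT T) (bU U) ((g.eta : ℂ)⁻¹) k) * G * conj b (diffLetter (bT T) (bU U) ((g.eta : ℂ)⁻¹) l)) (fun a a' => B₀ * Real.exp (-(δ₀ * g.dist a a'))))
    -- the block volumes of the bond carrier in the kernel pairing (p. 393) and [4] Lemma 2.1 for the block-volume weight `v^{−1/2}`, as FILE 39
    (cv : ℝ) (hvol : ∀ y : g.Site, c * ((Finset.univ.filter (fun q : (κ × S) × ι => blk q.1.2 = y)).card : ℝ) ≤ cv * v y)
    (hSTv : ∀ α : ℝ, 0 < α → ∃ Λ : ℝ, 1 ≤ Λ ∧ ScaleTransfer g δ₀ α Λ (fun y => (Real.sqrt (v y))⁻¹))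
    -- NEW: THEOREM 3.3's (3.46)₆ FOR `G(U)` in `L²` block form («‖hG(U)∇*_U∇*_UJ‖ ≦ B₀·1·|h|e^{−δ₀d(y,y′)}‖J‖»), every pair of concrete first differences
    (B46 : ℝ) (hB46 : 0 ≤ B46)
    (h346 : ∀ (k m : κ ⊕ κ) (y y'' : g.Site) (hf ν : (κ × S) × ι → ℝ) (Hh : ℝ), 0 ≤ Hh → (∀ x, |hf x| ≤ Hh) → (∀ x, blk x.1.2 ≠ y → hf x = 0) →
      (∀ x, blk x.1.2 ≠ y'' → ν x = 0) →
      Real.sqrt (∑ x, (hf x * (G * (conj b (diffLetter (bT T) (bU U) ((g.eta : ℂ)⁻¹) k)) * (conj b (diffLetter (bT T) (bU U) ((g.eta : ℂ)⁻¹) m))) ν x) ^ 2) ≤ B46 * Hh * Real.exp (-(δ₀ * g.dist y y'')) * Real.sqrt (∑ x, ν x ^ 2)) :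
    ∃ a₁ : ℝ, 0 < a₁ ∧ ∃ B : ℝ, 0 ≤ B ∧
    ∀ (α₁ : ℝ), 0 ≤ α₁ → α₁ ≤ a₁ →
    -- the exponent field `A` in the domain (3.37), read blockwise in the shapes of FILES 1–19, and the `A`-dependent (3.59) data `kF`, `sF`
    ∀ (A : κ → S → 𝔸) (kF : g.Site → S → 𝔸 →L[ℝ] 𝔸) (sF : S → 𝔸 →L[ℝ] 𝔸),
      (∀ y x, blk x = y → ‖kF y x‖ ≤ Cq * α₁ * w y) → (∀ x, ‖sF x‖ ≤ Cq * α₁) →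
      (∀ ν k x, ‖((g.eta : ℂ)⁻¹) • covDstar T U ν (A k) x‖ ≤ α₁ * (g.len (blk x) ^ 2)⁻¹) →
      (∀ μ ν x, ‖((g.eta : ℂ)⁻¹) • covD T U μ (A ν) x‖ ≤ α₁ * (g.len (blk x) ^ 2)⁻¹) →
      (∀ μ ν x, ‖((g.eta : ℂ)⁻¹) • covDstar T U ν (A ν) (T μ x)‖ ≤ α₁ * (g.len (blk x) ^ 2)⁻¹) →
      (∀ μ x, ‖((g.eta : ℂ)⁻¹) • covDstar T U μ (tauB T U μ (A μ)) x‖ ≤ α₁ * (g.len (blk x) ^ 2)⁻¹) →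
      (∀ μ ν k x, ‖((g.eta : ℂ)⁻¹) • covD T U μ (A k) ((T ν).symm x)‖ ≤ α₁ * (g.len (blk x) ^ 2)⁻¹) →
      (∀ k x, ‖A k x‖ ≤ α₁ * (g.len (blk x))⁻¹) → (∀ ν k x, ‖tauB T U ν (A k) x‖ ≤ α₁ * (g.len (blk x))⁻¹) →
      (∀ μ k x, ‖tauF T U μ (A k) x‖ ≤ α₁ * (g.len (blk x))⁻¹) →
      (∀ k μ ν x, ‖A k ((T ν).symm (T μ x))‖ ≤ α₁ * (g.len (blk x))⁻¹) →
      (∀ μ x m z, (m, z) ∈ stBonds T μ x → ‖A m z‖ ≤ α₁ * (g.len (blk x))⁻¹) →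
      (∀ μ x m z, (m, z) ∈ B9Eq375Locality.locBondsA T μ x → ‖A m z‖ ≤ α₁ * (g.len (blk x))⁻¹) →
      (∀ μ x m n y, Through T μ x m n y →
        ‖covD T U m (A n) y‖ ≤ g.eta * (α₁ * ((g.len (blk x))⁻¹) ^ 2) ∧ ‖covD T U n (A m) y‖ ≤ g.eta * (α₁ * ((g.len (blk x))⁻¹) ^ 2)) →
    -- the (3.57)/(3.59) letters `F′₂(A)`, `F′₂*(A)` (block-local, size `c_F α₁`)
    ∀ {Qc' Fc : (S × ι → ℝ) →ₗ[ℝ] (g.Site → ℝ)} {Qcs' Fcs : (g.Site → ℝ) →ₗ[ℝ] (S × ι → ℝ)},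
      Qc' = Qc + Fc → Qcs' = Qcs + Fcs →
      HasMajorantHom (g := toB6 g Rr H) (fun p : S × ι => blk p.1) (fun y : g.Site => y) Fc
        (fun a a' : g.Site => cF * α₁ * (if a = a' then (1 : ℝ) else 0)) →
      HasMajorantHom (g := toB6 g Rr H) (fun y : g.Site => y) (fun p : S × ι => blk p.1) Fcs
        (fun a a' : g.Site => cF * α₁ * (if a = a' then (1 : ℝ) else 0)) →
    -- the (3.80)–(3.81) letters `F₂(A)`, `F₂*(A)` («|F₂(A)|, |F₂*(A)| ≦ O(1)α₁»), `P₂(A)` of (3.82)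
    ∀ {P₂ Qs' Q' F₂ F₂s : Module.End ℝ ((κ × S) × ι → ℝ)},
      Q' = Q + F₂ → Qs' = Qs + F₂s → P₂ = pTwo Qs Q F₂ F₂s a →
      HasMajorant (g := toB6 g Rr H) (fun q : (κ × S) × ι => blk q.1.2) F₂ (fun a a' => cFb * α₁ * Real.exp (-(δ₀ * g.dist a a'))) →
      HasMajorant (g := toB6 g Rr H) (fun q : (κ × S) × ι => blk q.1.2) F₂s (fun a a' => cFb * α₁ * Real.exp (-(δ₀ * g.dist a a'))) →
    -- NEW: the COLUMN bounds of `F₂(A)`, `F₂*(A)` (transposes of the two majorants above; size `c_F α₁`)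
      (∀ (x' : (κ × S) × ι) (y'' : g.Site), (∑ z ∈ Finset.univ.filter (fun z : (κ × S) × ι => blk z.1.2 = y''), |F₂ (Pi.single x' 1) z|) ≤
        cFc * α₁ * Real.exp (-(δ₀ * g.dist y'' (blk x'.1.2)))) →
      (∀ (x' : (κ × S) × ι) (y'' : g.Site), (∑ z ∈ Finset.univ.filter (fun z : (κ × S) × ι => blk z.1.2 = y''), |F₂s (Pi.single x' 1) z|) ≤
        cFc * α₁ * Real.exp (-(δ₀ * g.dist y'' (blk x'.1.2)))) →
    ∃ (Tinv : Module.End ℝ (g.Site → ℝ)) (GExt : Module.End ℝ ((κ × S) × ι → ℝ)),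
      -- (ii) `C⁻¹(U′U)` = THE two-sided inverse of `Q′(U′U)G′²(U′U)Q′*(U′U)` (FILE 28, re-exported)
      Tinv * (Qc' ∘ₗ ((gPrimeExtEnd Gp (conj b (vPrimeConc T U g.eta A blk kQ kF sQ sF cfun) * Gp)) * (gPrimeExtEnd Gp (conj b (vPrimeConc T U g.eta A blk kQ kF sQ sF cfun) * Gp))) ∘ₗ Qcs') = 1 ∧
      (Qc' ∘ₗ ((gPrimeExtEnd Gp (conj b (vPrimeConc T U g.eta A blk kQ kF sQ sF cfun) * Gp)) * (gPrimeExtEnd Gp (conj b (vPrimeConc T U g.eta A blk kQ kF sQ sF cfun) * Gp))) ∘ₗ Qcs') * Tinv = 1 ∧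
      -- (iii) `G(U′U)` = THE two-sided inverse of the concrete `Δ_a(U′U)` built with this `C⁻¹(U′U)` (FILE 28, re-exported)
      deltaA (conj b (lapDDLetter T ((g.eta : ℂ)⁻¹) (prodCfg U g.eta A)))
          (conj b (dPrimeLetter T (prodCfg U g.eta A) g.eta))
          (conjHom b (gradLin T ((g.eta : ℂ)⁻¹) (prodCfg U g.eta A)) ∘ₗ (1 - ((Gp ∘ₗ Qcs ∘ₗ Linv ∘ₗ Qc ∘ₗ Gp) + (B9Eq360Vprime.pPrime Gp (gPrimeExtEnd Gp (conj b (vPrimeConc T U g.eta A blk kQ kF sQ sF cfun) * Gp)) (Qcs ∘ₗ secRes rep) (Qcs' ∘ₗ secRes rep) (secConj rep Linv) (secConj rep Tinv) (secExt rep ∘ₗ Qc) (secExt rep ∘ₗ Qc'))))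
            ∘ₗ conjHom b (divLin T ((g.eta : ℂ)⁻¹) (prodCfg U g.eta A))) Qs' a Q' * GExt = 1 ∧
      GExt *
      deltaA (conj b (lapDDLetter T ((g.eta : ℂ)⁻¹) (prodCfg U g.eta A)))
          (conj b (dPrimeLetter T (prodCfg U g.eta A) g.eta))
          (conjHom b (gradLin T ((g.eta : ℂ)⁻¹) (prodCfg U g.eta A)) ∘ₗ (1 - ((Gp ∘ₗ Qcs ∘ₗ Linv ∘ₗ Qc ∘ₗ Gp) + (B9Eq360Vprime.pPrime Gp (gPrimeExtEnd Gp (conj b (vPrimeConc T U g.eta A blk kQ kF sQ sF cfun) * Gp)) (Qcs ∘ₗ secRes rep) (Qcs' ∘ₗ secRes rep) (secConj rep Linv) (secConj rep Tinv) (secExt rep ∘ₗ Qc) (secExt rep ∘ₗ Qc'))))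
            ∘ₗ conjHom b (divLin T ((g.eta : ℂ)⁻¹) (prodCfg U g.eta A))) Qs' a Q' = 1 ∧
      -- (viii″) NEW: the `L²` member (3.46)₆ of Theorem 3.3 for THIS `G(U′U)`, every pair of concrete first differences on the RIGHT
      (∀ (k m : κ ⊕ κ) (y y' : g.Site) (hf μ : (κ × S) × ι → ℝ) (Hh : ℝ), 0 ≤ Hh → (∀ x, |hf x| ≤ Hh) → (∀ x, blk x.1.2 ≠ y → hf x = 0) →
        (∀ x, blk x.1.2 ≠ y' → μ x = 0) →
        Real.sqrt (∑ x, (hf x * (GExt * (conj b (diffLetter (bT T) (bU U) ((g.eta : ℂ)⁻¹) k)) * (conj b (diffLetter (bT T) (bU U) ((g.eta : ℂ)⁻¹) m))) μ x) ^ 2) ≤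
          B * Hh * Real.exp (-(1 / 50 * δ₀ * g.dist y y')) * Real.sqrt (∑ x, μ x ^ 2)) := by
  obtain ⟨y₀⟩ := ‹Nonempty g.Site›
  -- FILE 28 (identities, kernel entries of `G(U′U)`), FILE 33 ((3.68) kernel members of `P′(A)`)
  obtain ⟨a₁, ha₁, B', hB', H28⟩ := thm34_all_final (Rr := Rr) (H := H) b T U blk d δ₀ B₀ κQ BG B₁ cF Cq a₀ C₀ d₀ M₂ κQb cFb abar kQ sQ
    cfun w hB₀ hκQ hBG hB₁ hcF hCq ha₀ hC₀ hM₂ hδ₀ hκQb hcFb habar hdnn htri hrefl hsym hlen hlenη hη hL h261 hST hrepr hT hU1 h35 hd₀B hd₀F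
    hd₀FB hd₀st hd₀loc hd₀0 hw hcard hkQ hsQ hcfun h342_1 h342_2 h342_3 hΔpGp hGpΔp rep hrep hQc hQcs hLinv h348 hQb hQsb ha324 hΔG hGΔ hG hDG
    hGD hv hc hGk hDGk hGDk hDGDk
  obtain ⟨a₃, ha₃, KP, hKP, H33⟩ := thm34_pPrime_kernel_final (Rr := Rr) (H := H) b T U blk d δ₀ κQ BG B₁ cF Cq a₀ d₀ M₂ kQ sQ cfun w hκQ
    hBG hB₁ hcF hCq ha₀ hM₂ hδ₀ hdnn htri hrefl hsym hlen hlenη hη h261 hST hrepr hU1 hd₀B hd₀F hd₀0 hw hcard hkQ hsQ hcfun h342_1 h342_2 h342_3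
    rep hrep hQc hQcs hLinv h348 hΔpGp hGpΔp hv hc hGpk hDGpk hGpDk hDGpDk
  -- the geometry: exponents `1/100` at the printed rate `δ₀`; the `v⁻¹`-transfer at `δ₀/50` with `Λ_v²`
  obtain ⟨Λ, hΛ1, hT1, hT2, hT1i, hT2i, hT4i, -⟩ := hST (1 / 100) (by norm_num)
  have hΛ0 : 0 ≤ Λ := zero_le_one.trans hΛ1
  have h261β : Ineq261 d (toB6 g Rr H) δ₀ (1 / 100) := h261 _ (by norm_num) (by norm_num)
  have hc1 : 0 ≤ B6.c1 d δ₀ (1 / 100) := B6RandomWalk.c1_nonneg d δ₀ (1 / 100)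
  obtain ⟨Λv, hΛv1, hTv⟩ := hSTv (1 / 100) (by norm_num)
  have hΛv0 : 0 ≤ Λv := zero_le_one.trans hΛv1
  have hTv2 : ∀ a a' : g.Site, Real.exp (-(1 / 50 * δ₀ * g.dist a a')) * (v a)⁻¹ ≤ Λv ^ 2 * (v a')⁻¹ := by
    intro a a'
    have h1 := hTv a' a
    rw [hsym a' a] at h1
    have hs : 0 ≤ Real.exp (-(1 / 100 * δ₀ * g.dist a a')) * (Real.sqrt (v a))⁻¹ :=
      mul_nonneg (Real.exp_nonneg _) (inv_nonneg.mpr (Real.sqrt_nonneg _))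
    have h2 := mul_le_mul h1 h1 hs ((hs.trans h1))
    have e1 : Real.exp (-(1 / 100 * δ₀ * g.dist a a')) * (Real.sqrt (v a))⁻¹ * (Real.exp (-(1 / 100 * δ₀ * g.dist a a')) * (Real.sqrt (v a))⁻¹)
        = Real.exp (-(1 / 50 * δ₀ * g.dist a a')) * (v a)⁻¹ := by
      have hsq : (Real.sqrt (v a))⁻¹ * (Real.sqrt (v a))⁻¹ = (v a)⁻¹ := by
        rw [← mul_inv, Real.mul_self_sqrt (hv a).le]
      calc Real.exp (-(1 / 100 * δ₀ * g.dist a a')) * (Real.sqrt (v a))⁻¹ * (Real.exp (-(1 / 100 * δ₀ * g.dist a a')) * (Real.sqrt (v a))⁻¹)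
          = (Real.exp (-(1 / 100 * δ₀ * g.dist a a')) * Real.exp (-(1 / 100 * δ₀ * g.dist a a'))) * ((Real.sqrt (v a))⁻¹ * (Real.sqrt (v a))⁻¹) := by ring
        _ = Real.exp (-(1 / 50 * δ₀ * g.dist a a')) * (v a)⁻¹ := by
            rw [hsq, ← Real.exp_add]; congr 2; ring
    have e2 : Λv * (Real.sqrt (v a'))⁻¹ * (Λv * (Real.sqrt (v a'))⁻¹) = Λv ^ 2 * (v a')⁻¹ := by
      have hsq : (Real.sqrt (v a'))⁻¹ * (Real.sqrt (v a'))⁻¹ = (v a')⁻¹ := by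
        rw [← mul_inv, Real.mul_self_sqrt (hv a').le]
      calc Λv * (Real.sqrt (v a'))⁻¹ * (Λv * (Real.sqrt (v a'))⁻¹) = Λv ^ 2 * ((Real.sqrt (v a'))⁻¹ * (Real.sqrt (v a'))⁻¹) := by ring
        _ = Λv ^ 2 * (v a')⁻¹ := by rw [hsq]
    rw [e1, e2] at h2
    exact h2
  have hSTone : ScaleTransfer g δ₀ (1 / 100) Λ (fun _ : g.Site => (1 : ℝ)) := fun y y' => by
    simp only [mul_one]
    have h0 : 0 ≤ 1 / 100 * δ₀ * g.dist y y' := mul_nonneg (by linarith only [hδ₀]) (hdnn y y')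
    exact (Real.exp_le_one_iff.mpr (by linarith)).trans hΛ1
  have hcv : 0 ≤ cv := by
    have h4 : 0 ≤ c * ((Finset.univ.filter (fun q : (κ × S) × ι => blk q.1.2 = y₀)).card : ℝ) := by positivity
    have h0 : 0 * v y₀ ≤ cv * v y₀ := by rw [zero_mul]; exact h4.trans (hvol y₀)
    exact le_of_mul_le_mul_right h0 (hv y₀)
  have hl21 : ∀ a : g.Site, g.len a ^ 2 * (g.len a)⁻¹ = g.len a := fun a => by
    rw [pow_two, mul_assoc, mul_inv_cancel₀ (hlen a).ne', mul_one]
  have hn1 : ∀ a : g.Site, g.len a ^ 2 * (g.len a ^ 2)⁻¹ = 1 := fun a => mul_inv_cancel₀ (pow_ne_zero 2 (hlen a).ne')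
  have hw2 : ∀ a : g.Site, 0 ≤ g.len a ^ 2 := fun a => sq_nonneg _
  have hw2i : ∀ a : g.Site, 0 ≤ (g.len a ^ 2)⁻¹ := fun a => inv_nonneg.mpr (sq_nonneg _)
  -- rates
  have hδ10 : (0 : ℝ) ≤ 1 / 10 * δ₀ := by linarith only [hδ₀]
  have hρW0 : (0 : ℝ) ≤ 2 / 25 * δ₀ := by linarith only [hδ₀]
  have hγ0 : (0 : ℝ) ≤ 1 / 50 * δ₀ := by linarith only [hδ₀]
  have hrW : 2 / 25 * δ₀ + (1 / 100 + 1 / 100) * δ₀ ≤ 1 / 10 * δ₀ := by linarith only [hδ₀]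
  have hρ3 : (0 : ℝ) ≤ 3 / 50 * δ₀ := by linarith only [hδ₀]
  have hr3 : 3 / 50 * δ₀ + (1 / 100 + 1 / 100) * δ₀ ≤ 2 / 25 * δ₀ := by linarith only [hδ₀]
  have hρ4 : (0 : ℝ) ≤ 1 / 25 * δ₀ := by linarith only [hδ₀]
  have hr4' : 1 / 25 * δ₀ + (1 / 100 + 1 / 100) * δ₀ ≤ 3 / 50 * δ₀ := by linarith only [hδ₀]
  have h425 : 1 / 25 * δ₀ ≤ 2 / 25 * δ₀ := by linarith only [hδ₀]
  have hρ'' : (0 : ℝ) ≤ 1 / 50 * δ₀ := hγ0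
  have hρ'ρ : 3 / 100 * δ₀ + 1 / 100 * δ₀ ≤ 1 / 25 * δ₀ := by linarith only [hδ₀]
  have hρ''ρ' : 1 / 50 * δ₀ + 1 / 100 * δ₀ ≤ 3 / 100 * δ₀ := by linarith only [hδ₀]
  have hρ''r : 1 / 50 * δ₀ ≤ δ₀ := by linarith only [hδ₀]
  -- THE MIDDLE FACTOR `Q′*C⁻¹Q′` OF `R(U) = G′Q′*C⁻¹Q′G′` ((3.25)): block majorant `κ_M(Lʲη)⁻⁴e^{−(δ₀/10)d}` from (3.19) and the (3.48) kernel bound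
  have hr4 : ∀ a : g.Site, g.len a ^ (-(4 : ℝ)) = (g.len a ^ 4)⁻¹ := fun a => by
    rw [Real.rpow_neg (hlen a).le, show (4 : ℝ) = ((4 : ℕ) : ℝ) by norm_num, Real.rpow_natCast]
  have hLi : HasMajorant (g := toB6 g Rr H) (fun y : g.Site => y) Linv (fun a a' => B₁ * (g.len a ^ 4)⁻¹ * Real.exp (-(δ₀ * g.dist a a'))) :=
    hasMajorant_mono (g := toB6 g Rr H) _
      (hasMajorant_id_of_ker (R := Rr) (H := H) d hlen B₁ (fun y => g.len y ^ (-(4 : ℝ))) (fun y y' => Real.exp (-(δ₀ * g.dist y y'))) h348)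
      fun a a' => le_of_eq (by simp only [hr4])
  have hQc1 : HasMajorantHom (g := toB6 g Rr H) (fun p : S × ι => blk p.1) (fun y : g.Site => y) Qc (fun a a' : g.Site => if a = a' then κQ else 0) :=
    hasMajorantHom_mono (g := toB6 g Rr H) _ _ hQc fun a a' => le_of_eq (by split_ifs <;> simp)
  have hQcs1 : HasMajorantHom (g := toB6 g Rr H) (fun y : g.Site => y) (fun p : S × ι => blk p.1) Qcs (fun a a' : g.Site => if a = a' then κQ else 0) :=
    hasMajorantHom_mono (g := toB6 g Rr H) _ _ hQcs fun a a' => le_of_eq (by split_ifs <;> simp)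
  have hId : HasMajorantHom (g := toB6 g Rr H) (fun p : S × ι => blk p.1) (fun p : S × ι => blk p.1) (LinearMap.id : (S × ι → ℝ) →ₗ[ℝ] (S × ι → ℝ))
      (fun a a' => (1 : ℝ) * (fun _ : g.Site => (1 : ℝ)) a * Real.exp (-(δ₀ * g.dist a a'))) := by
    intro y' μ Bμ hμ x
    rw [LinearMap.id_apply]
    dsimp only
    by_cases hx : blk x.1 = y'
    · rw [hx, hrefl, mul_zero, neg_zero, Real.exp_zero]
      simpa using hμ.bound x hx
    · rw [hμ.off x hx, abs_zero]
      exact mul_nonneg (by positivity) hμ.nonneg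
  have hrM : 1 / 10 * δ₀ + (2 * (1 / 100) + 1 / 100) * δ₀ ≤ δ₀ := by linarith only [hδ₀]
  have hMid0 := hasMajorantHom_word349 (R := Rr) (H := H) (fun p : S × ι => blk p.1) (fun p : S × ι => blk p.1) (fun p : S × ι => blk p.1)
    (fun y : g.Site => y) d δ₀ δ₀ (1 / 100) (1 / 100) (1 / 10 * δ₀) Λ κQ 1 B₁ 1 (fun _ => (1 : ℝ)) (fun _ => (1 : ℝ)) (fun _ => zero_le_one)
    (fun _ => zero_le_one) hκQ.le zero_le_one hB₁.le zero_le_one hΛ1 hδ10 (by norm_num) (by norm_num) hδ₀.le hrM hdnn htri h261β hSTone hT4i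
    hId hId hQc1 hQcs1 hLi
  rw [LinearMap.id_comp, LinearMap.comp_id] at hMid0
  set κM : ℝ := κQ ^ 2 * B₁ * Λ ^ 4 * B6.c1 d δ₀ (1 / 100) ^ 2 with hκM
  have hκM0 : 0 ≤ κM := by rw [hκM]; positivity
  have hMid : HasMajorant (g := toB6 g Rr H) (fun p : S × ι => blk p.1) (Qcs ∘ₗ Linv ∘ₗ Qc)
      (fun a a' => κM * (g.len a ^ 4)⁻¹ * Real.exp (-(1 / 10 * δ₀ * g.dist a a'))) :=
    (hasMajorantHom_iff (g := toB6 g Rr H) _ _ _).mp (hasMajorantHom_mono (g := toB6 g Rr H) _ _ hMid0 fun a a' => le_of_eq (by rw [hκM]; ring))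
  -- THE CONSTANTS OF THE THREE PARTS OF THE KERNEL OF `W = G(U′U)V(A)` as functions of `α₁`, and their continuity bound («different constants»)
  set C1 : ℝ → ℝ := fun t =>
    Λv ^ 2 * Λ * B6.c1 d δ₀ (1 / 100) * B' * ((Fintype.card κ * ((2 * Fintype.card κ + 1) ^ 2 : ℕ) * Fintype.card ι) *
      (M₂ * (∑ i, ‖b i‖) * Real.exp ((2 / 25 * δ₀ + 1 / 50 * δ₀) * d₀)) * t *
        (2 * Fintype.card κ * (14 * (Fintype.card κ + 1))
          + (cV0 (Fintype.card κ) t C₀ + 2 * Fintype.card κ * (10 + 8 * Fintype.card κ + (16 * Fintype.card κ + 12) * C₀)))) with hC1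
  set C2 : ℝ → ℝ := fun t =>
    cv * B' * (((4 * (M₂ * ∑ i, ‖b i‖) * Real.exp (7 / 50 * δ₀ * d₀)) * BG * κM * BG * (Λ * B6.c1 d δ₀ (1 / 100)) ^ 3
        + BG * κM * BG * ((Fintype.card ι * M₂ * ∑ i, ‖b i‖) * (4 * Real.exp ((2 / 25 * δ₀ + 1 / 50 * δ₀) * d₀))) * Λv ^ 2 * (Λ * B6.c1 d δ₀ (1 / 100)) ^ 3
        + ((4 * (M₂ * ∑ i, ‖b i‖) * Real.exp (7 / 50 * δ₀ * d₀)) * t * BG * (Λ * B6.c1 d δ₀ (1 / 100))) * κM * BG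
            * ((Fintype.card ι * M₂ * ∑ i, ‖b i‖) * (4 * Real.exp ((2 / 25 * δ₀ + 1 / 50 * δ₀) * d₀))) * Λv ^ 2 * (Λ * B6.c1 d δ₀ (1 / 100)) ^ 3
        + KP * (1 + (4 * (M₂ * ∑ i, ‖b i‖) * Real.exp (3 / 25 * δ₀ * d₀)) * t * (Λ * B6.c1 d δ₀ (1 / 100))
            + ((Fintype.card ι * M₂ * ∑ i, ‖b i‖) * (4 * Real.exp ((2 / 25 * δ₀ + 1 / 50 * δ₀) * d₀))) * t * (Λv ^ 2 * Λ * B6.c1 d δ₀ (1 / 100))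
            + (4 * (M₂ * ∑ i, ‖b i‖) * Real.exp (3 / 25 * δ₀ * d₀)) * ((Fintype.card ι * M₂ * ∑ i, ‖b i‖) * (4 * Real.exp ((2 / 25 * δ₀ + 1 / 50 * δ₀) * d₀))) * t ^ 2
                * (Λv ^ 2 * (Λ * B6.c1 d δ₀ (1 / 100)) ^ 2))) * t) * Λ * B6.c1 d δ₀ (1 / 100) with hC2
  set C3 : ℝ → ℝ := fun t =>
    Λv ^ 2 * Λ * B6.c1 d δ₀ (1 / 100) * (Λv ^ 2 * Λ * B6.c1 d δ₀ (1 / 100) * (Λv ^ 2 * Λ * B6.c1 d δ₀ (1 / 100) * B' * (cFc * t)) * abarc) * κQc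
    + Λv ^ 2 * Λ * B6.c1 d δ₀ (1 / 100) * (Λv ^ 2 * Λ * B6.c1 d δ₀ (1 / 100) * (Λv ^ 2 * Λ * B6.c1 d δ₀ (1 / 100) * B' * κQc) * abarc) * (cFc * t)
    + Λv ^ 2 * Λ * B6.c1 d δ₀ (1 / 100) * (Λv ^ 2 * Λ * B6.c1 d δ₀ (1 / 100) * (Λv ^ 2 * Λ * B6.c1 d δ₀ (1 / 100) * B' * (cFc * t)) * abarc) * (cFc * t)
    with hC3
  obtain ⟨KW, ε₁, hKW, hε₁, hFW⟩ := exists_bound_of_continuousAt (f := fun t : ℝ => C1 t + C2 t + C3 t)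
    (by
      simp only [hC1, hC2, hC3]
      unfold B9Eq382V3Letters.cV0 B9Eq373V3.kΔ B9Eq373V3.kP
      fun_prop)
  have hBtot : 0 ≤ B46 * (1 + cv * Λv * KW * B6.c1 d δ₀ (1 / 100)) :=
    mul_nonneg hB46 (add_nonneg zero_le_one (mul_nonneg (mul_nonneg (mul_nonneg hcv hΛv0) hKW) hc1))
  refine ⟨min (min (min a₁ a₃) (1 / 4)) (ε₁ / 2),
    lt_min (lt_min (lt_min ha₁ ha₃) (by norm_num)) (half_pos hε₁), B46 * (1 + cv * Λv * KW * B6.c1 d δ₀ (1 / 100)), hBtot, ?_⟩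
  intro α₁ hα₁0 hα₁1 A kF sF hkF hsF h337B h337F h337B' h337Bτ h337FB hA hAτB hAτF hAFB hAst hAloc hdAst Qc' Fc Qcs' Fcs h357
    h357s hFc hFcs P₂ Qs' Q' F₂ F₂s h380 h380s hP₂def hF₂ hF₂s hF₂c hF₂sc
  have hα₁a : α₁ ≤ a₁ := hα₁1.trans ((min_le_left _ _).trans ((min_le_left _ _).trans (min_le_left _ _)))
  have hα₁b : α₁ ≤ a₃ := hα₁1.trans ((min_le_left _ _).trans ((min_le_left _ _).trans (min_le_right _ _)))
  have hα₁q : α₁ ≤ 1 / 4 := hα₁1.trans ((min_le_left _ _).trans (min_le_right _ _))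
  have habs : |α₁| = α₁ := abs_of_nonneg hα₁0
  have hα₁ε₁ : |α₁| < ε₁ := by rw [habs]; linarith only [hα₁1, min_le_right (min (min a₁ a₃) (1 / 4)) (ε₁ / 2), hε₁]
  -- FILE 28 at this `α₁`, `A`: the pair, identities, kernel entries `G(U′U)`, `G(U′U)∇_l`
  obtain ⟨-, -, -, -, Tinv, GExt, e1, e2, -, -, -, -, -, -, -, -, -, e3, e4, -, -, K1, -, K3, -⟩ := H28 α₁ hα₁0 hα₁a A kF sF hkF
    hsF h337B h337F h337B' h337Bτ h337FB hA hAτB hAτF hAFB hAst hAloc hdAst h357 h357s hFc hFcs h380 h380s hP₂def hF₂ hF₂s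
  -- FILE 33 at this `α₁`, `A`: ITS `C⁻¹(U′U)` coincides with FILE 28's, so the (3.68) kernel members hold for FILE 28's `P′(A)`
  obtain ⟨Tinv₃, f1, -, -, kP0, kP1, kP2, kP3⟩ := H33 α₁ hα₁0 hα₁b A kF sF hkF hsF h337B h337F h337Bτ hA hAτB h357 h357s hFc hFcs
  have hTT : Tinv₃ = Tinv := left_inv_eq_right_inv f1 e2
  rw [hTT] at kP0 kP1 kP2 kP3
  -- «η·α₁(Lʲη)⁻¹ ≦ 1/4»
  have hsmall : ∀ z : g.Site, g.eta * (α₁ * (g.len z)⁻¹) ≤ 1 / 4 := fun z => by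
    have hq : g.eta * (g.len z)⁻¹ ≤ 1 := by
      rw [← div_eq_mul_inv]; exact (div_le_one (hlen z)).mpr (hlenη z)
    calc g.eta * (α₁ * (g.len z)⁻¹) = α₁ * (g.eta * (g.len z)⁻¹) := by ring
      _ ≤ α₁ * 1 := mul_le_mul_of_nonneg_left hq hα₁0
      _ ≤ 1 / 4 := by linarith only [hα₁q]
  have hcV0 := cV0_nonneg (Fintype.card κ) hα₁0 hC₀
  have hC10 : 0 ≤ C1 α₁ := by simp only [hC1]; positivity
  have hC20 : 0 ≤ C2 α₁ := by simp only [hC2]; positivity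
  have hC30 : 0 ≤ C3 α₁ := by simp only [hC3]; positivity
  -- (3.84): `Δ_a(U′U) = Δ_a(U) − V(A)`, `V(A) = V₃(A) + P₁(A) + P₂(A)` — for FILE 28's concrete `Δ_a(U′U)`
  have hV₃' := conj_V₃Op_eq_vThree T U b g.eta A
  have h371 := conj_lapDDLetter_prodCfg (b := b) (T := T) (U := U) hη.ne' A
  have h384 : deltaA (conj b (lapDDLetter T ((g.eta : ℂ)⁻¹) (prodCfg U g.eta A)))
        (conj b (dPrimeLetter T (prodCfg U g.eta A) g.eta))
        (conjHom b (gradLin T ((g.eta : ℂ)⁻¹) (prodCfg U g.eta A)) ∘ₗ (1 - ((Gp ∘ₗ Qcs ∘ₗ Linv ∘ₗ Qc ∘ₗ Gp) + (B9Eq360Vprime.pPrime Gp (gPrimeExtEnd Gp (conj b (vPrimeConc T U g.eta A blk kQ kF sQ sF cfun) * Gp)) (Qcs ∘ₗ secRes rep) (Qcs' ∘ₗ secRes rep) (secConj rep Linv) (secConj rep Tinv) (secExt rep ∘ₗ Qc) (secExt rep ∘ₗ Qc'))))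
          ∘ₗ conjHom b (divLin T ((g.eta : ℂ)⁻¹) (prodCfg U g.eta A))) Qs' a Q' =
      deltaA (conj b (lapDDLetter T ((g.eta : ℂ)⁻¹) U)) (conj b (dPrimeLetter T U g.eta))
        (conjHom b (gradLin T ((g.eta : ℂ)⁻¹) U) ∘ₗ (1 - (Gp ∘ₗ Qcs ∘ₗ Linv ∘ₗ Qc ∘ₗ Gp)) ∘ₗ conjHom b (divLin T ((g.eta : ℂ)⁻¹) U)) Qs a Q -
        vTotal (conj b (V₃Op T U g.eta A))
          (((conjHom b (gradLin T ((g.eta : ℂ)⁻¹) (prodCfg U g.eta A)) - conjHom b (gradLin T ((g.eta : ℂ)⁻¹) U))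
              ∘ₗ (Gp ∘ₗ Qcs ∘ₗ Linv ∘ₗ Qc ∘ₗ Gp) ∘ₗ conjHom b (divLin T ((g.eta : ℂ)⁻¹) U)
            + conjHom b (gradLin T ((g.eta : ℂ)⁻¹) U) ∘ₗ (Gp ∘ₗ Qcs ∘ₗ Linv ∘ₗ Qc ∘ₗ Gp)
              ∘ₗ (conjHom b (divLin T ((g.eta : ℂ)⁻¹) (prodCfg U g.eta A)) - conjHom b (divLin T ((g.eta : ℂ)⁻¹) U))
            + (conjHom b (gradLin T ((g.eta : ℂ)⁻¹) (prodCfg U g.eta A)) - conjHom b (gradLin T ((g.eta : ℂ)⁻¹) U))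
              ∘ₗ (Gp ∘ₗ Qcs ∘ₗ Linv ∘ₗ Qc ∘ₗ Gp)
              ∘ₗ (conjHom b (divLin T ((g.eta : ℂ)⁻¹) (prodCfg U g.eta A)) - conjHom b (divLin T ((g.eta : ℂ)⁻¹) U))
            + conjHom b (gradLin T ((g.eta : ℂ)⁻¹) (prodCfg U g.eta A)) ∘ₗ (B9Eq360Vprime.pPrime Gp (gPrimeExtEnd Gp (conj b (vPrimeConc T U g.eta A blk kQ kF sQ sF cfun) * Gp)) (Qcs ∘ₗ secRes rep) (Qcs' ∘ₗ secRes rep) (secConj rep Linv) (secConj rep Tinv) (secExt rep ∘ₗ Qc) (secExt rep ∘ₗ Qc'))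
              ∘ₗ conjHom b (divLin T ((g.eta : ℂ)⁻¹) (prodCfg U g.eta A))))
          P₂ := by
    rw [eq384_sub (conj b (lapDDLetter T ((g.eta : ℂ)⁻¹) U)) (conj b (lapDDLetter T ((g.eta : ℂ)⁻¹) (prodCfg U g.eta A)))
      (conj b (dPrimeLetter T U g.eta)) (conj b (dPrimeLetter T (prodCfg U g.eta A) g.eta)) _ _ Qs Qs' Q Q' a
      (conj b (V₁Op T U g.eta A)) (conj b (V₂Op T U g.eta A)) _ F₂ F₂s h371
      (eq376_concrete T U b hη.ne' A (Gp ∘ₗ Qcs ∘ₗ Linv ∘ₗ Qc ∘ₗ Gp) (B9Eq360Vprime.pPrime Gp (gPrimeExtEnd Gp (conj b (vPrimeConc T U g.eta A blk kQ kF sQ sF cfun) * Gp)) (Qcs ∘ₗ secRes rep) (Qcs' ∘ₗ secRes rep) (secConj rep Linv) (secConj rep Tinv) (secExt rep ∘ₗ Qc) (secExt rep ∘ₗ Qc'))) h380 h380s, hV₃', hP₂def]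
  have hE := e4
  rw [h384] at hE
  -- (3.86): `G(U′U) = G(U) + G(U′U)V(A)G(U)`
  have hres := resolvent_right hΔG hE
  -- THE KERNEL OF `W = G(U′U)V(A)`.  (1) the `V₃(A)` part (FILE 42)
  have hK3' : ∀ k : κ ⊕ κ, HasKernelBound (g := toB6 g Rr H) (fun q : (κ × S) × ι => blk q.1.2) v c
      (GExt * conj b (diffLetter (bT T) (bU U) ((g.eta : ℂ)⁻¹) k))
      (fun a a' => B' * ((fun a : g.Site => g.len a ^ 2) a * (g.len a)⁻¹) * Real.exp (-(1 / 10 * δ₀ * g.dist a a'))) := fun k =>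
    hasKernelBound_mono (g := toB6 g Rr H) _ hv (K3 k) fun a a' => le_of_eq (by simp only [hl21])
  have hWV := hasKernelBound_mul_V₃_right (Rr := Rr) (H := H) b T U blk d hη hL A C₀ d₀ M₂
    (fun z : S => insert z (Finset.univ.image (fun a => T a z) ∪ Finset.univ.image (fun a => (T a).symm z)))
    (fun z : S => (insert z (Finset.univ.image (fun a => T a z) ∪ Finset.univ.image (fun a => (T a).symm z))).biUnion
        (fun w => insert w (Finset.univ.image (fun a => T a w) ∪ Finset.univ.image (fun a => (T a).symm w))))
    ((2 * Fintype.card κ + 1) ^ 2) δ₀ (1 / 100) (1 / 100) (1 / 50 * δ₀) (2 / 25 * δ₀) (1 / 10 * δ₀) Λ (Λv ^ 2) B' α₁ (fun a => g.len a ^ 2) hv hc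
    hB' hα₁0 hC₀ hM₂ hΛ0 (by positivity) hρW0 hγ0 hrW hdnn htri hlen h261β hw2 hT1i hT2i hTv2
    (fun z => nbhd₁_mem_self T z) (fun a z => nbhd₁_mem_fwd T a z) (fun a z => nbhd₁_mem_bwd T a z)
    (fun z z' z'' h₁ h₂ => nbhd₂_comp T z z' z'' h₁ h₂) (fun z z' h => nbhd₂_symm T z z' h) (fun z => nbhd₂_card T z)
    hrepr hsmall hT hU1 hA hAτB hAτF hAFB h337B h337F h337B' h337Bτ h337FB hAst hAloc hdAst h35 h35' hd₀B hd₀F hd₀FB hd₀st hd₀loc hd₀0 K1 hK3'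
  have hWV' : HasKernelBound (g := toB6 g Rr H) (fun q : (κ × S) × ι => blk q.1.2) v c (GExt * conj b (V₃Op T U g.eta A))
      (fun a a' => C1 α₁ * Real.exp (-(1 / 25 * δ₀ * g.dist a a'))) := by
    refine hasKernelBound_mono (g := toB6 g Rr H) _ hv hWV fun a a' => ?_
    refine mul_le_mul ?_ (exp_rate_mono h425 (hdnn a a')) (Real.exp_nonneg _) hC10
    rw [hn1 a, mul_one]
  -- (2) the `P₁(A)` part: block majorant of `G(U′U)` × the kernel of `P₁(A)` carried by its right letters (FILE 43)
  letI : DecidableEq (toB6 g Rr H).Site := ‹DecidableEq g.Site›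
  have hGEmaj : HasMajorant (g := toB6 g Rr H) (fun q : (κ × S) × ι => blk q.1.2) GExt
      (fun a a' => (cv * B') * g.len a ^ 2 * Real.exp (-(1 / 10 * δ₀ * g.dist a a'))) :=
    hasMajorant_mono (g := toB6 g Rr H) _
      (hasMajorant_of_hasKernelBound (g := toB6 g Rr H) _ hv hc hvol (fun a a' => by positivity) K1) fun a a' => le_of_eq (by ring)
  have hs25 : 2 / 25 * δ₀ + (1 / 100 + 1 / 100) * δ₀ ≤ 1 / 10 * δ₀ := hrW
  have hs10 : 1 / 10 * δ₀ + (1 / 100 + 1 / 100) * δ₀ ≤ 3 / 25 * δ₀ := by linarith only [hδ₀]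
  have hs12 : 3 / 25 * δ₀ + (1 / 100 + 1 / 100) * δ₀ ≤ 7 / 50 * δ₀ := by linarith only [hδ₀]
  have hP1k := hasKernelBound_pOne_right (Rr := Rr) (H := H) b T U blk d hη A d₀ M₂ δ₀ (1 / 100) (1 / 100) (1 / 50 * δ₀) (2 / 25 * δ₀)
    (1 / 10 * δ₀) (3 / 25 * δ₀) (7 / 50 * δ₀) δ₀ (1 / 10 * δ₀) (1 / 4 * δ₀) Λ (Λv ^ 2) BG κM KP α₁ hBG.le hκM0 hKP hα₁0 hM₂ hΛ1 (by positivity)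
    hρW0 (by norm_num) (by norm_num) hγ0 hδ₀.le hs25 hs10 hs12 (by linarith only [hδ₀]) le_rfl (by linarith only [hδ₀]) hdnn htri hlen h261β
    hT1 hT2 hT1i hT2i hT4i hv hc hTv2 hrepr hU1 hA (fun ν x => hAτB ν ν x) hsmall hd₀F hd₀B
    (R := (Gp ∘ₗ Qcs ∘ₗ Linv ∘ₗ Qc ∘ₗ Gp)) (Mid := Qcs ∘ₗ Linv ∘ₗ Qc) rfl h342_1 (fun μ => h342_2 (Sum.inl μ)) hGpk
    (fun ν => hGpDk (Sum.inr ν)) hMid kP0 (fun μ => kP1 (Sum.inl μ)) (fun ν => kP2 (Sum.inr ν)) (fun μ ν => kP3 (Sum.inl μ) (Sum.inr ν))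
  have hWP := hasKernelBound_comp_decay (R := Rr) (H := H) (fun q : (κ × S) × ι => blk q.1.2) d δ₀ (1 / 100) (1 / 100) (2 / 25 * δ₀)
    (1 / 10 * δ₀) Λ (cv * B') _ (fun a => g.len a ^ 2) (fun a => (g.len a ^ 2)⁻¹) hw2 hw2i hΛ0 (mul_nonneg hcv hB') (by positivity) hρW0 hrW
    hdnn htri hT2i h261β hv hc hGEmaj hP1k
  have hWP' : HasKernelBound (g := toB6 g Rr H) (fun q : (κ × S) × ι => blk q.1.2) v c
      (GExt * (((conjHom b (gradLin T ((g.eta : ℂ)⁻¹) (prodCfg U g.eta A)) - conjHom b (gradLin T ((g.eta : ℂ)⁻¹) U))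
              ∘ₗ (Gp ∘ₗ Qcs ∘ₗ Linv ∘ₗ Qc ∘ₗ Gp) ∘ₗ conjHom b (divLin T ((g.eta : ℂ)⁻¹) U)
            + conjHom b (gradLin T ((g.eta : ℂ)⁻¹) U) ∘ₗ (Gp ∘ₗ Qcs ∘ₗ Linv ∘ₗ Qc ∘ₗ Gp)
              ∘ₗ (conjHom b (divLin T ((g.eta : ℂ)⁻¹) (prodCfg U g.eta A)) - conjHom b (divLin T ((g.eta : ℂ)⁻¹) U))
            + (conjHom b (gradLin T ((g.eta : ℂ)⁻¹) (prodCfg U g.eta A)) - conjHom b (gradLin T ((g.eta : ℂ)⁻¹) U))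
              ∘ₗ (Gp ∘ₗ Qcs ∘ₗ Linv ∘ₗ Qc ∘ₗ Gp)
              ∘ₗ (conjHom b (divLin T ((g.eta : ℂ)⁻¹) (prodCfg U g.eta A)) - conjHom b (divLin T ((g.eta : ℂ)⁻¹) U))
            + conjHom b (gradLin T ((g.eta : ℂ)⁻¹) (prodCfg U g.eta A)) ∘ₗ (B9Eq360Vprime.pPrime Gp (gPrimeExtEnd Gp (conj b (vPrimeConc T U g.eta A blk kQ kF sQ sF cfun) * Gp)) (Qcs ∘ₗ secRes rep) (Qcs' ∘ₗ secRes rep) (secConj rep Linv) (secConj rep Tinv) (secExt rep ∘ₗ Qc) (secExt rep ∘ₗ Qc'))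
              ∘ₗ conjHom b (divLin T ((g.eta : ℂ)⁻¹) (prodCfg U g.eta A)))))
      (fun a a' => C2 α₁ * Real.exp (-(1 / 25 * δ₀ * g.dist a a'))) := by
    refine hasKernelBound_mono (g := toB6 g Rr H) _ hv hWP fun a a' => ?_
    refine mul_le_mul ?_ (exp_rate_mono h425 (hdnn a a')) (Real.exp_nonneg _) hC20
    rw [hn1 a, mul_one]
  -- (3) the `P₂(A)` part: the three words `G(U′U)·L₁·a·L₃`, kernel × column × column × column
  have colw1 : ∀ {L : Module.End ℝ ((κ × S) × ι → ℝ)} {AS : ℝ} (ρ' : ℝ), 0 ≤ AS → ρ' ≤ δ₀ →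
      (∀ (x' : (κ × S) × ι) (y'' : g.Site), (∑ z ∈ Finset.univ.filter (fun z : (κ × S) × ι => blk z.1.2 = y''), |L (Pi.single x' 1) z|) ≤
        AS * Real.exp (-(δ₀ * g.dist y'' (blk x'.1.2)))) →
      ∀ (x' : (κ × S) × ι) (y'' : g.Site), (∑ z ∈ Finset.univ.filter (fun z : (κ × S) × ι => blk z.1.2 = y''), |L (Pi.single x' 1) z|) ≤
        AS * 1 * Real.exp (-(ρ' * g.dist y'' (blk x'.1.2))) := fun ρ' hAS hρ' h x' y'' =>
    (h x' y'').trans (by rw [mul_one]; exact mul_le_mul_of_nonneg_left (exp_rate_mono hρ' (hdnn _ _)) hAS)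
  have cola : ∀ (ρ' : ℝ), ρ' ≤ δ₀ →
      ∀ (x' : (κ × S) × ι) (y'' : g.Site), (∑ z ∈ Finset.univ.filter (fun z : (κ × S) × ι => blk z.1.2 = y''), |a (Pi.single x' 1) z|) ≤
        abarc * (g.len y'' ^ 2)⁻¹ * Real.exp (-(ρ' * g.dist y'' (blk x'.1.2))) := fun ρ' hρ' x' y'' =>
    (hacol x' y'').trans (mul_le_mul_of_nonneg_left (exp_rate_mono hρ' (hdnn _ _)) (mul_nonneg habarc (hw2i _)))
  have hcα : 0 ≤ cFc * α₁ := mul_nonneg hcFc hα₁0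
  have hcol1 : 2 / 25 * δ₀ + 1 / 50 * δ₀ ≤ δ₀ := by linarith only [hδ₀]
  have hcol2 : 3 / 50 * δ₀ + 1 / 50 * δ₀ ≤ δ₀ := by linarith only [hδ₀]
  have hcol3 : 1 / 25 * δ₀ + 1 / 50 * δ₀ ≤ δ₀ := by linarith only [hδ₀]
  -- word A: `G(U′U)·F₂*·a·Q`
  have sA1 := hasKernelBound_mul_col (R := Rr) (H := H) (fun q : (κ × S) × ι => blk q.1.2) hv hc d (γ := 1 / 50 * δ₀) (ρ := 2 / 25 * δ₀)
    (fun a => g.len a ^ 2) (fun _ => (1 : ℝ)) hw2 (fun _ => zero_le_one) hB' hcα hΛ0 (by positivity) hρW0 hrW hdnn htri hSTone h261β hTv2 K1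
    (colw1 (2 / 25 * δ₀ + 1 / 50 * δ₀) hcα hcol1 hF₂sc)
  have sA2 := hasKernelBound_mul_col (R := Rr) (H := H) (fun q : (κ × S) × ι => blk q.1.2) hv hc d (γ := 1 / 50 * δ₀) (ρ := 3 / 50 * δ₀)
    (fun a => g.len a ^ 2 * 1) (fun a => (g.len a ^ 2)⁻¹) (fun a => by rw [mul_one]; exact hw2 a) hw2i (by positivity) habarc hΛ0 (by positivity)
    hρ3 hr3 hdnn htri hT2i h261β hTv2 sA1 (cola (3 / 50 * δ₀ + 1 / 50 * δ₀) hcol2)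
  have sA3 := hasKernelBound_mul_col (R := Rr) (H := H) (fun q : (κ × S) × ι => blk q.1.2) hv hc d (γ := 1 / 50 * δ₀) (ρ := 1 / 25 * δ₀)
    (fun a => g.len a ^ 2 * 1 * (g.len a ^ 2)⁻¹) (fun _ => (1 : ℝ)) (fun a => by rw [mul_one, hn1 a]; exact zero_le_one) (fun _ => zero_le_one)
    (by positivity) hκQc hΛ0 (by positivity) hρ4 hr4' hdnn htri hSTone h261β hTv2 sA2 (colw1 (1 / 25 * δ₀ + 1 / 50 * δ₀) hκQc hcol3 hQcol)
  -- word B: `G(U′U)·Q*·a·F₂`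
  have sB1 := hasKernelBound_mul_col (R := Rr) (H := H) (fun q : (κ × S) × ι => blk q.1.2) hv hc d (γ := 1 / 50 * δ₀) (ρ := 2 / 25 * δ₀)
    (fun a => g.len a ^ 2) (fun _ => (1 : ℝ)) hw2 (fun _ => zero_le_one) hB' hκQc hΛ0 (by positivity) hρW0 hrW hdnn htri hSTone h261β hTv2 K1
    (colw1 (2 / 25 * δ₀ + 1 / 50 * δ₀) hκQc hcol1 hQscol)
  have sB2 := hasKernelBound_mul_col (R := Rr) (H := H) (fun q : (κ × S) × ι => blk q.1.2) hv hc d (γ := 1 / 50 * δ₀) (ρ := 3 / 50 * δ₀)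
    (fun a => g.len a ^ 2 * 1) (fun a => (g.len a ^ 2)⁻¹) (fun a => by rw [mul_one]; exact hw2 a) hw2i (by positivity) habarc hΛ0 (by positivity)
    hρ3 hr3 hdnn htri hT2i h261β hTv2 sB1 (cola (3 / 50 * δ₀ + 1 / 50 * δ₀) hcol2)
  have sB3 := hasKernelBound_mul_col (R := Rr) (H := H) (fun q : (κ × S) × ι => blk q.1.2) hv hc d (γ := 1 / 50 * δ₀) (ρ := 1 / 25 * δ₀)
    (fun a => g.len a ^ 2 * 1 * (g.len a ^ 2)⁻¹) (fun _ => (1 : ℝ)) (fun a => by rw [mul_one, hn1 a]; exact zero_le_one) (fun _ => zero_le_one)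
    (by positivity) hcα hΛ0 (by positivity) hρ4 hr4' hdnn htri hSTone h261β hTv2 sB2 (colw1 (1 / 25 * δ₀ + 1 / 50 * δ₀) hcα hcol3 hF₂c)
  -- word C: `G(U′U)·F₂*·a·F₂`
  have sC3 := hasKernelBound_mul_col (R := Rr) (H := H) (fun q : (κ × S) × ι => blk q.1.2) hv hc d (γ := 1 / 50 * δ₀) (ρ := 1 / 25 * δ₀)
    (fun a => g.len a ^ 2 * 1 * (g.len a ^ 2)⁻¹) (fun _ => (1 : ℝ)) (fun a => by rw [mul_one, hn1 a]; exact zero_le_one) (fun _ => zero_le_one)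
    (by positivity) hcα hΛ0 (by positivity) hρ4 hr4' hdnn htri hSTone h261β hTv2 sA2 (colw1 (1 / 25 * δ₀ + 1 / 50 * δ₀) hcα hcol3 hF₂c)
  have hn3 : ∀ a : g.Site, g.len a ^ 2 * 1 * (g.len a ^ 2)⁻¹ * 1 = 1 := fun a => by rw [mul_one, mul_one, hn1 a]
  have hWP₂ : HasKernelBound (g := toB6 g Rr H) (fun q : (κ × S) × ι => blk q.1.2) v c
      (GExt * F₂s * a * Q + GExt * Qs * a * F₂ + GExt * F₂s * a * F₂) (fun a a' => C3 α₁ * Real.exp (-(1 / 25 * δ₀ * g.dist a a'))) := by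
    refine hasKernelBound_mono (g := toB6 g Rr H) _ hv (hasKernelBound_add _ (hasKernelBound_add _ sA3 sB3) sC3) fun z z' => ?_
    rw [hn3 z, mul_one, mul_one, mul_one]
    exact le_of_eq (by simp only [hC3]; ring)
  -- the sum: `W = G(U′U)V(A)`, `|W(x,x′)| ≦ K_W e^{−(δ₀/25)d}v(y′)⁻¹`
  have hP₂eq : GExt * P₂ = -(GExt * F₂s * a * Q + GExt * Qs * a * F₂ + GExt * F₂s * a * F₂) := by
    rw [hP₂def]
    apply LinearMap.ext
    intro f
    simp only [pTwo, Module.End.mul_apply, LinearMap.neg_apply, LinearMap.add_apply, map_neg, map_add]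
  have hWeq : GExt * vTotal (conj b (V₃Op T U g.eta A))
          (((conjHom b (gradLin T ((g.eta : ℂ)⁻¹) (prodCfg U g.eta A)) - conjHom b (gradLin T ((g.eta : ℂ)⁻¹) U))
              ∘ₗ (Gp ∘ₗ Qcs ∘ₗ Linv ∘ₗ Qc ∘ₗ Gp) ∘ₗ conjHom b (divLin T ((g.eta : ℂ)⁻¹) U)
            + conjHom b (gradLin T ((g.eta : ℂ)⁻¹) U) ∘ₗ (Gp ∘ₗ Qcs ∘ₗ Linv ∘ₗ Qc ∘ₗ Gp)
              ∘ₗ (conjHom b (divLin T ((g.eta : ℂ)⁻¹) (prodCfg U g.eta A)) - conjHom b (divLin T ((g.eta : ℂ)⁻¹) U))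
            + (conjHom b (gradLin T ((g.eta : ℂ)⁻¹) (prodCfg U g.eta A)) - conjHom b (gradLin T ((g.eta : ℂ)⁻¹) U))
              ∘ₗ (Gp ∘ₗ Qcs ∘ₗ Linv ∘ₗ Qc ∘ₗ Gp)
              ∘ₗ (conjHom b (divLin T ((g.eta : ℂ)⁻¹) (prodCfg U g.eta A)) - conjHom b (divLin T ((g.eta : ℂ)⁻¹) U))
            + conjHom b (gradLin T ((g.eta : ℂ)⁻¹) (prodCfg U g.eta A)) ∘ₗ (B9Eq360Vprime.pPrime Gp (gPrimeExtEnd Gp (conj b (vPrimeConc T U g.eta A blk kQ kF sQ sF cfun) * Gp)) (Qcs ∘ₗ secRes rep) (Qcs' ∘ₗ secRes rep) (secConj rep Linv) (secConj rep Tinv) (secExt rep ∘ₗ Qc) (secExt rep ∘ₗ Qc'))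
              ∘ₗ conjHom b (divLin T ((g.eta : ℂ)⁻¹) (prodCfg U g.eta A))))
          P₂ =
      GExt * conj b (V₃Op T U g.eta A)
      + GExt * (((conjHom b (gradLin T ((g.eta : ℂ)⁻¹) (prodCfg U g.eta A)) - conjHom b (gradLin T ((g.eta : ℂ)⁻¹) U))
              ∘ₗ (Gp ∘ₗ Qcs ∘ₗ Linv ∘ₗ Qc ∘ₗ Gp) ∘ₗ conjHom b (divLin T ((g.eta : ℂ)⁻¹) U)
            + conjHom b (gradLin T ((g.eta : ℂ)⁻¹) U) ∘ₗ (Gp ∘ₗ Qcs ∘ₗ Linv ∘ₗ Qc ∘ₗ Gp)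
              ∘ₗ (conjHom b (divLin T ((g.eta : ℂ)⁻¹) (prodCfg U g.eta A)) - conjHom b (divLin T ((g.eta : ℂ)⁻¹) U))
            + (conjHom b (gradLin T ((g.eta : ℂ)⁻¹) (prodCfg U g.eta A)) - conjHom b (gradLin T ((g.eta : ℂ)⁻¹) U))
              ∘ₗ (Gp ∘ₗ Qcs ∘ₗ Linv ∘ₗ Qc ∘ₗ Gp)
              ∘ₗ (conjHom b (divLin T ((g.eta : ℂ)⁻¹) (prodCfg U g.eta A)) - conjHom b (divLin T ((g.eta : ℂ)⁻¹) U))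
            + conjHom b (gradLin T ((g.eta : ℂ)⁻¹) (prodCfg U g.eta A)) ∘ₗ (B9Eq360Vprime.pPrime Gp (gPrimeExtEnd Gp (conj b (vPrimeConc T U g.eta A blk kQ kF sQ sF cfun) * Gp)) (Qcs ∘ₗ secRes rep) (Qcs' ∘ₗ secRes rep) (secConj rep Linv) (secConj rep Tinv) (secExt rep ∘ₗ Qc) (secExt rep ∘ₗ Qc'))
              ∘ₗ conjHom b (divLin T ((g.eta : ℂ)⁻¹) (prodCfg U g.eta A))))
      + -(GExt * F₂s * a * Q + GExt * Qs * a * F₂ + GExt * F₂s * a * F₂) := by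
    rw [← hP₂eq]
    apply LinearMap.ext
    intro f
    simp only [vTotal, Module.End.mul_apply, LinearMap.add_apply, map_add]
  have hKWb : C1 α₁ + C2 α₁ + C3 α₁ ≤ KW := hFW α₁ hα₁ε₁
  have hW : HasKernelBound (g := toB6 g Rr H) (fun q : (κ × S) × ι => blk q.1.2) v c
      (GExt * vTotal (conj b (V₃Op T U g.eta A))
          (((conjHom b (gradLin T ((g.eta : ℂ)⁻¹) (prodCfg U g.eta A)) - conjHom b (gradLin T ((g.eta : ℂ)⁻¹) U))
              ∘ₗ (Gp ∘ₗ Qcs ∘ₗ Linv ∘ₗ Qc ∘ₗ Gp) ∘ₗ conjHom b (divLin T ((g.eta : ℂ)⁻¹) U)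
            + conjHom b (gradLin T ((g.eta : ℂ)⁻¹) U) ∘ₗ (Gp ∘ₗ Qcs ∘ₗ Linv ∘ₗ Qc ∘ₗ Gp)
              ∘ₗ (conjHom b (divLin T ((g.eta : ℂ)⁻¹) (prodCfg U g.eta A)) - conjHom b (divLin T ((g.eta : ℂ)⁻¹) U))
            + (conjHom b (gradLin T ((g.eta : ℂ)⁻¹) (prodCfg U g.eta A)) - conjHom b (gradLin T ((g.eta : ℂ)⁻¹) U))
              ∘ₗ (Gp ∘ₗ Qcs ∘ₗ Linv ∘ₗ Qc ∘ₗ Gp)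
              ∘ₗ (conjHom b (divLin T ((g.eta : ℂ)⁻¹) (prodCfg U g.eta A)) - conjHom b (divLin T ((g.eta : ℂ)⁻¹) U))
            + conjHom b (gradLin T ((g.eta : ℂ)⁻¹) (prodCfg U g.eta A)) ∘ₗ (B9Eq360Vprime.pPrime Gp (gPrimeExtEnd Gp (conj b (vPrimeConc T U g.eta A blk kQ kF sQ sF cfun) * Gp)) (Qcs ∘ₗ secRes rep) (Qcs' ∘ₗ secRes rep) (secConj rep Linv) (secConj rep Tinv) (secExt rep ∘ₗ Qc) (secExt rep ∘ₗ Qc'))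
              ∘ₗ conjHom b (divLin T ((g.eta : ℂ)⁻¹) (prodCfg U g.eta A))))
          P₂)
      (fun a a' => KW * Real.exp (-(1 / 25 * δ₀ * g.dist a a'))) := by
    rw [hWeq]
    refine hasKernelBound_mono (g := toB6 g Rr H) _ hv
      (hasKernelBound_add _ (hasKernelBound_add _ hWV' hWP') (hasKernelBound_neg' _ hWP₂)) fun z z' => ?_
    have e : C1 α₁ * Real.exp (-(1 / 25 * δ₀ * g.dist z z')) + C2 α₁ * Real.exp (-(1 / 25 * δ₀ * g.dist z z'))
        + C3 α₁ * Real.exp (-(1 / 25 * δ₀ * g.dist z z')) = (C1 α₁ + C2 α₁ + C3 α₁) * Real.exp (-(1 / 25 * δ₀ * g.dist z z')) := by ring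
    rw [e]
    exact mul_le_mul_of_nonneg_right hKWb (Real.exp_nonneg _)
  refine ⟨Tinv, GExt, e1, e2, e3, e4, ?_⟩
  intro k m y y' hf μ Hh hHh hh hh0 hμ0
  -- `G(U′U)∇_k∇_m = G(U)∇_k∇_m + [G(U′U)V(A)]·(G(U)∇_k∇_m)` ((3.86))
  have hEid : GExt * (conj b (diffLetter (bT T) (bU U) ((g.eta : ℂ)⁻¹) k)) * (conj b (diffLetter (bT T) (bU U) ((g.eta : ℂ)⁻¹) m)) =
      G * (conj b (diffLetter (bT T) (bU U) ((g.eta : ℂ)⁻¹) k)) * (conj b (diffLetter (bT T) (bU U) ((g.eta : ℂ)⁻¹) m)) +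
      (GExt * vTotal (conj b (V₃Op T U g.eta A))
          (((conjHom b (gradLin T ((g.eta : ℂ)⁻¹) (prodCfg U g.eta A)) - conjHom b (gradLin T ((g.eta : ℂ)⁻¹) U))
              ∘ₗ (Gp ∘ₗ Qcs ∘ₗ Linv ∘ₗ Qc ∘ₗ Gp) ∘ₗ conjHom b (divLin T ((g.eta : ℂ)⁻¹) U)
            + conjHom b (gradLin T ((g.eta : ℂ)⁻¹) U) ∘ₗ (Gp ∘ₗ Qcs ∘ₗ Linv ∘ₗ Qc ∘ₗ Gp)
              ∘ₗ (conjHom b (divLin T ((g.eta : ℂ)⁻¹) (prodCfg U g.eta A)) - conjHom b (divLin T ((g.eta : ℂ)⁻¹) U))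
            + (conjHom b (gradLin T ((g.eta : ℂ)⁻¹) (prodCfg U g.eta A)) - conjHom b (gradLin T ((g.eta : ℂ)⁻¹) U))
              ∘ₗ (Gp ∘ₗ Qcs ∘ₗ Linv ∘ₗ Qc ∘ₗ Gp)
              ∘ₗ (conjHom b (divLin T ((g.eta : ℂ)⁻¹) (prodCfg U g.eta A)) - conjHom b (divLin T ((g.eta : ℂ)⁻¹) U))
            + conjHom b (gradLin T ((g.eta : ℂ)⁻¹) (prodCfg U g.eta A)) ∘ₗ (B9Eq360Vprime.pPrime Gp (gPrimeExtEnd Gp (conj b (vPrimeConc T U g.eta A blk kQ kF sQ sF cfun) * Gp)) (Qcs ∘ₗ secRes rep) (Qcs' ∘ₗ secRes rep) (secConj rep Linv) (secConj rep Tinv) (secExt rep ∘ₗ Qc) (secExt rep ∘ₗ Qc'))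
              ∘ₗ conjHom b (divLin T ((g.eta : ℂ)⁻¹) (prodCfg U g.eta A))))
          P₂) * (G * (conj b (diffLetter (bT T) (bU U) ((g.eta : ℂ)⁻¹) k)) * (conj b (diffLetter (bT T) (bU U) ((g.eta : ℂ)⁻¹) m))) := by
    conv_lhs => rw [hres]
    noncomm_ring
  exact l2_right_transfer (R := Rr) (H := H) (fun q : (κ × S) × ι => blk q.1.2) hv hc hvol d hB46 hKW hρ'' hρ'ρ hρ''ρ' hρ''r hdnn htri h261β hTv
    hEid (h346 k m) hW y y' hf μ Hh hHh hh hh0 hμ0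

end FinalG

end Literature.MathematicalPhysics.QuantumFieldTheory.Balaban1983to89.B9Ineq346L2RightDiffG

end
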